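/-
Copyright: the b2b-balaban T⁴-continuum CRUX team, row NE7b OWNER lineage `t4-ne7b-p1` (gen 141). Project licence.
-/
import Mathlib.Data.Real.Basic
import Mathlib.Tactic

/-!
# THE FOURTH-ORDER CUMULANT IDENTITY (pure algebra; SCOPING (d13)(2): the cumulant FORM of `∂⁴W`, fifth file).  (516)'s RAW fourth derivative
# `Z⁻¹Φ′ + Z⁻²G_mΦ + Z⁻²Σ(G′H + GH′) + 2Z⁻³G_mΣGH + 2Z⁻³ΣG′GG + 6Z⁻⁴G_mGGG`, once every composite tilted integral is split into the 51 canonical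
# monomial integrals `x_M = ∫e^{−U}M` (`M` a product of entries `A_v = U′v`, `B_{vw} = U″vw`, `C_{uvw} = U‴uvw`, `D = U⁗hklm`; `Z = ∫e^{−U}`),
# EQUALS the cumulant form
#   `⟨D⟩ − Σ₄Cov(C,A) − Σ₃Cov(B,B′) + Σ₆κ₃(B,A,A′) − κ₄(A_h,A_k,A_l,A_m)`,   `κ₄ = E[ÂÂÂÂ] − Σ₃E[ÂÂ]E[ÂÂ]` (`Â = A − E A`, `E = Z⁻¹∫e^{−U}·`),
# written out in the same letters — the set-partition (Leonov–Shiryaev) expansion of the fourth derivative of `W = −log Z` at the level of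
# letters; an identity of rational functions in 52 real variables, checked by `field_simp; ring` (and symbolically before typing).  The next
# file substitutes the integrals (row NE7b, node U5c; Mathlib only; [folklore])

Cell `pub-balaban`, sub-cell `t4`, spine estimate NE7b (`T4WeightBudget.RelWeightBound`; the cell's OWN estimate — NOT PRINTED in
[Bałaban 1983–89], NOT PROVED).  Crux-route work under `Spine/NE7b/` by the row OWNER (`t4-ne7b-p1` gen 141, file (517)) under FREEZE
(0)'s crux-prover clause; NOTHING of Bałaban's is named as a Lean object, valued or asserted; no `T4Continuum/Support` leaf typed; no
`def`, no notation; zero `sorry`.  Imports: Mathlib only.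

WHAT IS PROVED ([folklore]): **`fourth_cumulant_identity`**; §2 toy.

HONEST (what this is NOT).  Letters only; the substitution of the tilted integrals (splitting (516)'s composite integrands into canonical
monomials by linearity, integrability from (513)) and the assembly of the order-4 kernel letter are the next files.  Scalar skeleton ((A3),
NC-NE7b-α UNRULED); nothing of Bałaban's asserted.  BY-NAME EFFECT ON THE WALL: NONE.  NE7b NOT PRINTED ∕ NOT PROVED; spine PROVED 0∕9; rung
(B)+1 — the programme's measures remain FINITE-torus statements; NOT the mass gap, NOT Clay.  HONEST DEPENDENCY: continuum YM on T⁴ ⇐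
BetaPertH ∧ nine spine estimates (0∕9 proved); BetaPertH ⇐ (D1) ∧ (D4) ∧ CAP+tail; G-an2-4 gates asym, D1 and NE2∕3∕4.
-/

set_option autoImplicit false

namespace Summit.QuantumFields.BalabanUV.T4Continuum.NE7b.SupFourthCumulantIdentity

/-! ## §1. The identity -/

/-- **THE FOURTH-ORDER CUMULANT IDENTITY**: raw fourth derivative (split into canonical monomial letters) = `⟨D⟩ − Σ₄Cov(C,A) − Σ₃Cov(B,B′)
+ Σ₆κ₃(B,A,A′) − κ₄`, for `Z ≠ 0`. [folklore] -/
theorem fourth_cumulant_identity (Z xAh xAh_Ak xAh_Ak_Al xAh_Ak_Al_Am xAh_Ak_Am xAh_Ak_Blm xAh_Al xAh_Al_Am xAh_Al_Bkm xAh_Am xAh_Am_Bkl xAh_Bkl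
    xAh_Bkm xAh_Blm xAh_Cklm xAk xAk_Al xAk_Al_Am xAk_Al_Bhm xAk_Am xAk_Am_Bhl xAk_Bhl xAk_Bhm xAk_Blm xAk_Chlm xAl xAl_Am xAl_Am_Bhk xAl_Bhk xAl_Bhm
    xAl_Bkm xAl_Chkm xAm xAm_Bhk xAm_Bhl xAm_Bkl xAm_Chkl xBhk xBhk_Blm xBhl xBhl_Bkm xBhm xBhm_Bkl xBkl xBkm xBlm xChkl xChkm xChlm xCklm xDhklm :
    ℝ) (hZ : Z ≠ 0) :
    Z⁻¹ * (-(xAh_Ak_Al_Am) + xAh_Ak_Blm + xAh_Al_Bkm + xAh_Am_Bkl - (xAh_Cklm) + xAk_Al_Bhm + xAk_Am_Bhl - (xAk_Chlm) + xAl_Am_Bhk - (xAl_Chkm) -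
        (xAm_Chkl) - (xBhk_Blm) - (xBhl_Bkm) - (xBhm_Bkl) + xDhklm) - -(xAm) * (Z ^ 2)⁻¹ * (xAh_Ak_Al - (xAh_Bkl) - (xAk_Bhl) - (xAl_Bhk) + xChkl) +
        ((Z ^ 2)⁻¹ * ((-(xAh_Am) + xBhm) * (-(xAk_Al) + xBkl) + (xAh) * (xAk_Al_Am - (xAk_Blm) - (xAl_Bkm) - (xAm_Bkl) + xCklm)) - 2 * -(xAm) * (Z ^
            3)⁻¹ * ((xAh) * (-(xAk_Al) + xBkl))) +
        ((Z ^ 2)⁻¹ * ((-(xAk_Am) + xBkm) * (-(xAh_Al) + xBhl) + (xAk) * (xAh_Al_Am - (xAh_Blm) - (xAl_Bhm) - (xAm_Bhl) + xChlm)) - 2 * -(xAm) * (Z ^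
            3)⁻¹ * ((xAk) * (-(xAh_Al) + xBhl))) +
        ((Z ^ 2)⁻¹ * ((xAh_Ak_Am - (xAh_Bkm) - (xAk_Bhm) - (xAm_Bhk) + xChkm) * (xAl) + (-(xAh_Ak) + xBhk) * (-(xAl_Am) + xBlm)) - 2 * -(xAm) * (Z ^
            3)⁻¹ * ((-(xAh_Ak) + xBhk) * (xAl))) +
        (2 * (Z ^ 3)⁻¹ * ((-(xAh_Am) + xBhm) * (xAk) * (xAl) + (xAh) * (-(xAk_Am) + xBkm) * (xAl) + (xAh) * (xAk) * (-(xAl_Am) + xBlm)) -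
          6 * -(xAm) * (Z ^ 4)⁻¹ * ((xAh) * (xAk) * (xAl))) =
      (Z⁻¹ * xDhklm) -
        (-(Z⁻¹ * Z⁻¹ * xAh * xCklm) - (Z⁻¹ * Z⁻¹ * xAk * xChlm) - (Z⁻¹ * Z⁻¹ * xAl * xChkm) - (Z⁻¹ * Z⁻¹ * xAm * xChkl) + Z⁻¹ * xAh_Cklm + Z⁻¹ *
            xAk_Chlm + Z⁻¹ * xAl_Chkm + Z⁻¹ * xAm_Chkl) -
        (-(Z⁻¹ * Z⁻¹ * xBhk * xBlm) - (Z⁻¹ * Z⁻¹ * xBhl * xBkm) - (Z⁻¹ * Z⁻¹ * xBhm * xBkl) + Z⁻¹ * xBhk_Blm + Z⁻¹ * xBhl_Bkm + Z⁻¹ * xBhm_Bkl) +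
        (2 * Z⁻¹ * Z⁻¹ * Z⁻¹ * xAh * xAk * xBlm + 2 * Z⁻¹ * Z⁻¹ * Z⁻¹ * xAh * xAl * xBkm + 2 * Z⁻¹ * Z⁻¹ * Z⁻¹ * xAh * xAm * xBkl + 2 * Z⁻¹ * Z⁻¹ *
            Z⁻¹ * xAk * xAl * xBhm + 2 * Z⁻¹ * Z⁻¹ * Z⁻¹ * xAk * xAm * xBhl + 2 * Z⁻¹ * Z⁻¹ * Z⁻¹ * xAl * xAm * xBhk - (Z⁻¹ * Z⁻¹ * xAh * xAk_Blm) -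
            (Z⁻¹ * Z⁻¹ * xAh * xAl_Bkm) - (Z⁻¹ * Z⁻¹ * xAh * xAm_Bkl) - (Z⁻¹ * Z⁻¹ * xAh_Ak * xBlm) - (Z⁻¹ * Z⁻¹ * xAh_Al * xBkm) - (Z⁻¹ * Z⁻¹ *
            xAh_Am * xBkl) - (Z⁻¹ * Z⁻¹ * xAh_Bkl * xAm) - (Z⁻¹ * Z⁻¹ * xAh_Bkm * xAl) - (Z⁻¹ * Z⁻¹ * xAh_Blm * xAk) - (Z⁻¹ * Z⁻¹ * xAk * xAl_Bhm) -
            (Z⁻¹ * Z⁻¹ * xAk * xAm_Bhl) - (Z⁻¹ * Z⁻¹ * xAk_Al * xBhm) - (Z⁻¹ * Z⁻¹ * xAk_Am * xBhl) - (Z⁻¹ * Z⁻¹ * xAk_Bhl * xAm) - (Z⁻¹ * Z⁻¹ *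
            xAk_Bhm * xAl) - (Z⁻¹ * Z⁻¹ * xAl * xAm_Bhk) - (Z⁻¹ * Z⁻¹ * xAl_Am * xBhk) - (Z⁻¹ * Z⁻¹ * xAl_Bhk * xAm) + Z⁻¹ * xAh_Ak_Blm + Z⁻¹ *
            xAh_Al_Bkm + Z⁻¹ * xAh_Am_Bkl + Z⁻¹ * xAk_Al_Bhm + Z⁻¹ * xAk_Am_Bhl + Z⁻¹ * xAl_Am_Bhk) -
        (-(6 * Z⁻¹ * Z⁻¹ * Z⁻¹ * Z⁻¹ * xAh * xAk * xAl * xAm) + 2 * Z⁻¹ * Z⁻¹ * Z⁻¹ * xAh * xAk * xAl_Am + 2 * Z⁻¹ * Z⁻¹ * Z⁻¹ * xAh * xAk_Al * xAm +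
            2 * Z⁻¹ * Z⁻¹ * Z⁻¹ * xAh * xAk_Am * xAl + 2 * Z⁻¹ * Z⁻¹ * Z⁻¹ * xAh_Ak * xAl * xAm + 2 * Z⁻¹ * Z⁻¹ * Z⁻¹ * xAh_Al * xAk * xAm + 2 * Z⁻¹
            * Z⁻¹ * Z⁻¹ * xAh_Am * xAk * xAl - (Z⁻¹ * Z⁻¹ * xAh * xAk_Al_Am) - (Z⁻¹ * Z⁻¹ * xAh_Ak * xAl_Am) - (Z⁻¹ * Z⁻¹ * xAh_Ak_Al * xAm) - (Z⁻¹ *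
            Z⁻¹ * xAh_Ak_Am * xAl) - (Z⁻¹ * Z⁻¹ * xAh_Al * xAk_Am) - (Z⁻¹ * Z⁻¹ * xAh_Al_Am * xAk) - (Z⁻¹ * Z⁻¹ * xAh_Am * xAk_Al) + Z⁻¹ *
            xAh_Ak_Al_Am) := by
  field_simp
  ring

/-! ## §2. Toy -/

/-- Toy (the identity's `Z`-homogeneity in numbers): `2·(1∕2)³ = 1∕4`. -/
example : (2 : ℝ) * ((1 : ℝ) / 2) ^ 3 = 1 / 4 := by norm_num

end Summit.QuantumFields.BalabanUV.T4Continuum.NE7b.SupFourthCumulantIdentity
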